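import Mathlib.Analysis.Calculus.FDeriv.Analytic
import Mathlib.Analysis.Analytic.Uniqueness
import Mathlib.Analysis.InnerProductSpace.Adjoint
import Mathlib.Analysis.Calculus.Deriv.Shift
import Literature.NumberTheory.Automorphic.AutomorphicRepsGLIrreducibleL2Proofs
import Literature.NumberTheory.Automorphic.AutomorphicFormsL2Derivative
import HarnessLib

/-!
# Harish-Chandra's closure theorem from the analyticity of `K`-finite matrix coefficients
(decomposition of `AutomorphicRepsGL.formsOfL2_closure_exp_invariant` and of
`AutomorphicRepsGL.cuspidal_closure_exp_invariant`; the closure argument PROVED)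

Topic `NumberTheory/Automorphic`; sibling file of `AutomorphicRepsGLCuspidalL2Step3` (named fact
F3a, `AutomorphicRepsGL.formsOfL2_closure_exp_invariant hcpt μ`: for an irreducible closed
invariant `Π ≤ L²_cusp(GL_n(𝔸_K) ⧸ A_G GL_n(K), μ)` and a `(𝔤, K_∞) × GL_n(𝔸_K^∞)`-stable
`W ≤ V_Π`, the `L²`-closure of the classes of `W` is invariant under `R(exp X)`, `X ∈ 𝔤`) and of
`AutomorphicRepsGLIrreducibleL2Proofs` (named fact `AutomorphicRepsGL.cuspidal_closure_exp_invariant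
hcpt μ`, the same for any stable space `W` of `A_G`-invariant cusp forms).

In print both are the Corollary to Theorem 2 of Harish-Chandra 1953 (p. 211; Libine 2012,
Cor. 73): if `ψ₀` lies in a `π(𝔅)`-stable space `U` of well-behaved vectors and `φ` is a
continuous functional vanishing on `U`, then `x ↦ φ(π(x) ψ₀)` is an analytic function on `G`
all of whose derivatives at `1` are values of `φ` on `π(𝔅) ψ₀ ⊆ U`, hence `0`; so it vanishes
identically (`G` connected), and `π(x) ψ₀ ∈ Cl(U)` by Hahn–Banach. The ONLY non-elementary input
is that the vectors in question are well-behaved, i.e. that their matrix coefficients are real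
analytic: Harish-Chandra 1953, Lemma 34 (p. 228: in a representation all of whose `K`-isotypic
components are finite-dimensional every `K`-finite vector is well-behaved) with Thm. 6 (p. 230:
irreducible unitary representations qualify); Libine 2012, Thm. 58 (b) and Thm. 72
(`V_fini ⊆ V^ω`: for `v` `K`-finite and `l ∈ V^*`, `g ↦ ⟨l, π(g) v⟩` is real analytic). This file
isolates that input as ONE named fact, stated for the classes of the spaces `V_Π`, and PROVES
everything else:

* `AutomorphicRepsGL.formsOfL2_coeff_analyticAt hcpt μ` (**named fact**, Harish-Chandra's
  Lemma 34 for cuspidal `Π` on `GL_n`, weak form along one-parameter subgroups): for an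
  irreducible closed invariant `Π ≤ L²_cusp`, `f ∈ ℒ²(μ)` with `invQuot f ∈ V_Π`, `X ∈ 𝔤` and
  `u ∈ L²(μ)`, the matrix coefficient `t ↦ ⟪u, R(exp tX) [f]⟫` is real analytic at `t = 0`.
* `closure_l2OfForms_exp_invariant_of_analytic` (**proved**, the Corollary to Theorem 2 along
  `exp tX`, for any adelic group datum, automorphy datum and finite invariant measure): if `W` is
  a `𝔤`-stable space of bounded archimedean-smooth functions of the form `invQuot f`,
  `f ∈ ℒ²(μ)`, whose classes have matrix coefficients `t ↦ ⟪u, R(exp tX) [f]⟫` analytic at `0`,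
  then the closure of `[W] = l2OfForms W` is `R(exp X)`-invariant. Proof: for `u ⊥ [W]` the
  coefficient `c(t) = ⟪u, R(exp tX) [f]⟫` is analytic on all of `ℝ` (translate: `c(t₀ + s) =
  ⟪R(exp t₀X)^* u, R(exp sX) [f]⟫`); its derivative is the coefficient of the class of the Lie
  derivative `X (invQuot f) ∈ W` (`tendsto_slope_rightRegular_toLp` of
  `AutomorphicFormsL2Derivative`: the `L²`-difference quotients converge by dominated
  convergence, the Lie derivative being bounded), so by induction all `iteratedDeriv k c 0` are
  inner products of `u` with classes of `W`, i.e. `0`; Taylor's formula for analytic functions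
  (`HasFPowerSeriesOnBall.hasSum_iteratedFDeriv`) makes `c` vanish near `0`, the identity theorem
  (`AnalyticOnNhd.eqOn_zero_of_preconnected_of_eventuallyEq_zero`) on `ℝ`, and `Cl[W] = [W]ᗮᗮ`.
* `AutomorphicRepsGL.formsOfL2_closure_exp_invariant_of_coeff_analyticAt` (**proved**): the
  named facts `cuspidal_bounded hcpt` (Getz–Hahn Thm. 9.8.1: elements of `V_Π ≤ 𝒜₀` are bounded,
  so that their Lie derivatives, again in `W`, are bounded) and `formsOfL2_coeff_analyticAt hcpt μ`
  imply F3a `formsOfL2_closure_exp_invariant hcpt μ`.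
* `AutomorphicRepsGL.coeff_analyticAt_of_mem_iSup_formsOfL2` (**proved**): analyticity at `0`
  of the coefficients of `[f]` whenever `invQuot f ∈ ⨆_Π V_Π` (finite sums), given the named
  fact; hence (`AutomorphicRepsGL.cuspidal_closure_exp_invariant_of_coeff_analyticAt`,
  **proved**) `cuspidal_bounded hcpt`, `invQuot_mem_iSup_formsOfL2 hcpt μ` (Getz–Hahn, proof of
  Thm. 6.5.1 with Cor. 9.1.2: a square-integrable cusp form lies in finitely many `V_Π`) and
  `formsOfL2_coeff_analyticAt hcpt μ` imply `cuspidal_closure_exp_invariant hcpt μ`.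

So the trust base of F3a becomes `{formsOfL2_coeff_analyticAt, cuspidal_bounded}` and that of
Harish-Chandra's closure theorem for cusp forms
`{formsOfL2_coeff_analyticAt, cuspidal_bounded, invQuot_mem_iSup_formsOfL2}`, all three being
separately printed theorems already used elsewhere in the tree or strictly smaller than the
facts they replace.

## Design notes

* The named fact is the WEAK analyticity of Libine's Thm. 72 (scalar coefficients against every
  `u ∈ L²`), at `t = 0` only and only along the one-parameter subgroups `exp tX` — exactly what
  the Corollary consumes; Harish-Chandra's Lemma 34 (strong analyticity of `x ↦ π(x) ψ₀` on `G`)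
  implies it. It quantifies over `Π : CuspidalAutomorphicRepGL n K μ` and `invQuot f ∈ V_Π` like
  F3a/F3b (hypotheses complete: `[(gl n K).IsAutomorphicMeasure μ]`; in print the admissibility
  of the irreducible unitary `Π`, Harish-Chandra 1953 Thm. 6 / Getz–Hahn Thm. 4.4.1, makes
  Lemma 34 applicable to the `K_∞`-finite `U`-invariant vector `[f]`).
* The closure argument is stated once, for a general datum (`closure_l2OfForms_exp_invariant_of_
  analytic`), with the four properties of `W` it uses as hypotheses (Lie-stable; archimedean-
  smooth; bounded; represented by `ℒ²`-functions) plus analyticity; the two `GL_n` corollaries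
  only discharge these from `IsStableSubmodule`, `cuspidal_bounded` and the structure of `V_Π`.
* Boundedness enters only through `tendsto_slope_rightRegular_toLp` (dominated convergence); no
  new variant of `cuspidal_bounded` is introduced. Nothing restates F3a or the cuspidal closure
  theorem; no definition besides the named fact; no instance.

## References

* Harish-Chandra, *Representations of a semisimple Lie group on a Banach space. I*, Trans. AMS 75
  (1953), 185–243 (held): §7 (well-behaved vectors, p. 209), Thm. 2 and its Corollary
  (pp. 209–211), Lemma 34 and Thm. 5 (pp. 228–229), Thm. 6 (p. 230) [HarishChandraTAMS1953].
* M. Libine, *Introduction to Representations of Real Semisimple Lie Groups* (Schmid's course),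
  arXiv:1212.2578 (held): Thm. 58, Thm. 72, Cor. 73 [Libine2012].
* J. R. Getz, H. Hahn, *An Introduction to Automorphic Representations*, GTM 300 (2024) (held):
  Thm. 4.4.1, Prop. 4.4.2 (p. 81), Thm. 6.5.1–6.5.2 and the proof of Thm. 6.5.1 (p. 192),
  Cor. 9.1.2, Thm. 9.8.1 [GetzHahn2024].
* A. Borel, H. Jacquet, *Automorphic forms and automorphic representations*, Proc. Sympos. Pure
  Math. 33 (Corvallis 1977), Part 1 (1979), §4.6 [BorelJacquetCorvallis1979] (not held).
-/

open scoped MatrixGroups Matrix ContDiff Classical Topology InnerProductSpace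
open NumberField NumberField.mixedEmbedding IsDedekindDomain Filter
open _root_.MeasureTheory

noncomputable section

namespace Literature.NumberTheory.Automorphic

/-! ## The Corollary to Harish-Chandra's Theorem 2 along one-parameter subgroups (proved) -/

section Core

variable {K : Type} [Field K] [NumberField K] {𝒢 : AdelicGroupData K}
  {μ : Measure 𝒢.automorphicQuotient} [IsFiniteMeasure μ]
  [SMulInvariantMeasure 𝒢.Adelic 𝒢.automorphicQuotient μ]
  {A : Type*} [NormedCommRing A] [NormedAlgebra ℝ A] [NormedAlgebra ℚ A] [CompleteSpace A]
  [StarRing A] {N : Type*} [Fintype N] [DecidableEq N] (𝒟 : AutomorphyDatum 𝒢 A N)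

omit [IsFiniteMeasure μ] in
/-- `t ↦ R(exp tX)` is a one-parameter group of operators on `L²(μ)`:
`R(exp tX) v = R(exp t₀X) (R(exp (t - t₀)X) v)` (`expMem_add_smul`). Harish-Chandra 1953, §7.
[folklore] -/
theorem rightRegular_expMem_smul_apply_eq (X : 𝒟.arch.lie) (t₀ t : ℝ) (v : 𝒢.L2 μ) :
    𝒢.rightRegular μ (𝒟.ofArch (𝒟.arch.expMem (t • X))) v =
      𝒢.rightRegular μ (𝒟.ofArch (𝒟.arch.expMem (t₀ • X)))
        (𝒢.rightRegular μ (𝒟.ofArch (𝒟.arch.expMem ((t - t₀) • X))) v) := by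
  have e : t₀ + (t - t₀) = t := by ring
  rw [← mul_apply_eq_comp, ← map_mul, ← map_mul, ← RealMatrixGroup.expMem_add_smul, e]

omit [IsFiniteMeasure μ] in
/-- **Translation of matrix coefficients along a one-parameter subgroup**:
`⟪u, R(exp tX) v⟫ = ⟪R(exp t₀X)^* u, R(exp (t - t₀)X) v⟫`. This is how analyticity (and
differentiability) of a coefficient at `t = 0` for all `u` propagates to every `t₀`
(Harish-Chandra 1953, §7, p. 209: "it is sufficient that it should be analytic at `1`"). [folklore] -/
theorem inner_rightRegular_expMem_smul_eq (X : 𝒟.arch.lie) (t₀ t : ℝ) (u v : 𝒢.L2 μ) :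
    ⟪u, 𝒢.rightRegular μ (𝒟.ofArch (𝒟.arch.expMem (t • X))) v⟫_ℂ =
      ⟪ContinuousLinearMap.adjoint (𝒢.rightRegular μ (𝒟.ofArch (𝒟.arch.expMem (t₀ • X)))) u,
        𝒢.rightRegular μ (𝒟.ofArch (𝒟.arch.expMem ((t - t₀) • X))) v⟫_ℂ := by
  rw [rightRegular_expMem_smul_apply_eq 𝒟 X t₀ t v, ContinuousLinearMap.adjoint_inner_left]

omit [IsFiniteMeasure μ] in
/-- If the coefficients `t ↦ ⟪u, R(exp tX) v⟫` are analytic at `0` for every `u ∈ L²(μ)`, they are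
analytic at every `t₀ ∈ ℝ` (translate by `R(exp t₀X)^*`, `inner_rightRegular_expMem_smul_eq`).
Harish-Chandra 1953, §7 (p. 209). [folklore] -/
theorem analyticAt_inner_rightRegular_of_zero (X : 𝒟.arch.lie) (v : 𝒢.L2 μ)
    (h : ∀ u : 𝒢.L2 μ,
      AnalyticAt ℝ (fun t : ℝ ↦ ⟪u, 𝒢.rightRegular μ (𝒟.ofArch (𝒟.arch.expMem (t • X))) v⟫_ℂ) 0)
    (u : 𝒢.L2 μ) (t₀ : ℝ) :
    AnalyticAt ℝ (fun t : ℝ ↦ ⟪u, 𝒢.rightRegular μ (𝒟.ofArch (𝒟.arch.expMem (t • X))) v⟫_ℂ) t₀ := by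
  set u' := ContinuousLinearMap.adjoint (𝒢.rightRegular μ (𝒟.ofArch (𝒟.arch.expMem (t₀ • X)))) u
  have key : (fun t : ℝ ↦ ⟪u, 𝒢.rightRegular μ (𝒟.ofArch (𝒟.arch.expMem (t • X))) v⟫_ℂ) =
      (fun s : ℝ ↦ ⟪u', 𝒢.rightRegular μ (𝒟.ofArch (𝒟.arch.expMem (s • X))) v⟫_ℂ) ∘
        fun t : ℝ ↦ t - t₀ := by
    funext t
    exact inner_rightRegular_expMem_smul_eq 𝒟 X t₀ t u v
  rw [key]
  exact (h u').comp_of_eq (analyticAt_id.sub analyticAt_const) (sub_self t₀)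

/-- **The coefficient of the class of the Lie derivative is the derivative of the coefficient.**
If `φ = invQuot f` is archimedean-smooth with bounded Lie derivative `X φ = invQuot f_X`
(`f, f_X ∈ ℒ²(μ)`, `μ` finite invariant), then for every `u ∈ L²(μ)` and `t₀ ∈ ℝ` the coefficient
`t ↦ ⟪u, R(exp tX) [f]⟫` has derivative `⟪u, R(exp t₀X) [f_X]⟫` at `t₀`: at `t₀ = 0` this is the
`L²`-convergence of the difference quotients (`tendsto_slope_rightRegular_toLp`), and the general
case follows by translation (`inner_rightRegular_expMem_smul_eq`). Harish-Chandra 1953, §7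
(p. 209: `π_W(X) ψ = lim t⁻¹ {π(exp tX) ψ - ψ}`) and proof of Thm. 5 (p. 229).
[cite: HarishChandraTAMS1953, §7 (p. 209) and Thm. 5 (proof, p. 229)] -/
theorem hasDerivAt_inner_rightRegular_toLp {f f_X : 𝒢.automorphicQuotient → ℂ}
    (hf : MemLp f 2 μ) (hfX : MemLp f_X 2 μ) (hφ : IsArchSmooth 𝒟.ofArch (invQuot 𝒢 f))
    (X : 𝒟.arch.lie) (hX : lieDeriv 𝒟.ofArch X (invQuot 𝒢 f) = invQuot 𝒢 f_X) {C : ℝ}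
    (hC : ∀ g, ‖invQuot 𝒢 f_X g‖ ≤ C) (u : 𝒢.L2 μ) (t₀ : ℝ) :
    HasDerivAt (fun t : ℝ ↦ ⟪u, 𝒢.rightRegular μ (𝒟.ofArch (𝒟.arch.expMem (t • X))) (hf.toLp f)⟫_ℂ)
      ⟪u, 𝒢.rightRegular μ (𝒟.ofArch (𝒟.arch.expMem (t₀ • X))) (hfX.toLp f_X)⟫_ℂ t₀ := by
  -- the `L²`-valued orbit map is differentiable at `0` with derivative `[f_X]`
  have hγ : HasDerivAt
      (fun t : ℝ ↦ 𝒢.rightRegular μ (𝒟.ofArch (𝒟.arch.expMem (t • X))) (hf.toLp f))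
      (hfX.toLp f_X) 0 := by
    rw [hasDerivAt_iff_tendsto_slope]
    refine (tendsto_slope_rightRegular_toLp 𝒟 hf hfX hφ X hX hC).congr' ?_
    refine eventually_nhdsWithin_of_forall fun t _ ↦ ?_
    rw [slope_def_module, sub_zero, RealMatrixGroup.expMem_zero_smul, map_one, map_one,
      one_apply_eq_self]
  -- scalar coefficients at `0`, for every `u'`
  have h0 : ∀ u' : 𝒢.L2 μ, HasDerivAt
      (fun t : ℝ ↦ ⟪u', 𝒢.rightRegular μ (𝒟.ofArch (𝒟.arch.expMem (t • X))) (hf.toLp f)⟫_ℂ)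
      ⟪u', hfX.toLp f_X⟫_ℂ 0 := by
    intro u'
    have := ((innerSL ℂ u').restrictScalars ℝ).hasFDerivAt.comp_hasDerivAt 0 hγ
    simpa only [Function.comp_def, ContinuousLinearMap.coe_restrictScalars',
      innerSL_apply_apply] using this
  -- translate to `t₀`
  set u' := ContinuousLinearMap.adjoint (𝒢.rightRegular μ (𝒟.ofArch (𝒟.arch.expMem (t₀ • X)))) u
  have key : (fun t : ℝ ↦
      ⟪u, 𝒢.rightRegular μ (𝒟.ofArch (𝒟.arch.expMem (t • X))) (hf.toLp f)⟫_ℂ) =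
      fun t : ℝ ↦ ⟪u', 𝒢.rightRegular μ (𝒟.ofArch (𝒟.arch.expMem ((t - t₀) • X))) (hf.toLp f)⟫_ℂ := by
    funext t
    exact inner_rightRegular_expMem_smul_eq 𝒟 X t₀ t u (hf.toLp f)
  have hval : ⟪u', hfX.toLp f_X⟫_ℂ =
      ⟪u, 𝒢.rightRegular μ (𝒟.ofArch (𝒟.arch.expMem (t₀ • X))) (hfX.toLp f_X)⟫_ℂ :=
    ContinuousLinearMap.adjoint_inner_left _ _ _
  rw [key, ← hval]
  have h1 := h0 u'
  rw [← sub_self t₀] at h1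
  exact h1.comp_sub_const t₀ t₀

omit [IsFiniteMeasure μ] [SMulInvariantMeasure 𝒢.Adelic 𝒢.automorphicQuotient μ] in
/-- A linear operator mapping a subspace into the closure of that subspace maps the closure into
itself (continuity). [folklore] -/
theorem apply_mem_topologicalClosure_of_forall_mem {S : Submodule ℂ (𝒢.L2 μ)}
    (T : 𝒢.L2 μ →L[ℂ] 𝒢.L2 μ) (hT : ∀ x ∈ S, T x ∈ S.topologicalClosure) {y : 𝒢.L2 μ}
    (hy : y ∈ S.topologicalClosure) : T y ∈ S.topologicalClosure := by
  have hsub : closure (S : Set (𝒢.L2 μ)) ⊆ T ⁻¹' (S.topologicalClosure : Set (𝒢.L2 μ)) :=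
    closure_minimal (fun x hx ↦ hT x hx) (S.isClosed_topologicalClosure.preimage T.continuous)
  rw [← Submodule.topologicalClosure_coe] at hsub
  exact hsub hy

/-- **Harish-Chandra's closure theorem along one-parameter subgroups, from analyticity of the
coefficients** (Harish-Chandra 1953, Corollary to Thm. 2, pp. 210–211; Libine 2012, Cor. 73).
Let `μ` be a finite invariant measure on the automorphic quotient of an adelic group datum with
an automorphy datum `𝒟`, and let `W` be a space of functions on `G(𝔸_K)` which is stable under
the Lie derivatives `X φ`, `X ∈ 𝔤`, and whose elements are archimedean-smooth, bounded, and of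
the form `invQuot f = (g ↦ f [g⁻¹])` with `f ∈ ℒ²(μ)`. Suppose that for every `f ∈ ℒ²(μ)` with
`invQuot f ∈ W` the matrix coefficients `t ↦ ⟪u, R(exp tX) [f]⟫`, `u ∈ L²(μ)`, `X ∈ 𝔤`, are real
analytic at `t = 0` (the elements of `[W]` are well-behaved). Then for every `X ∈ 𝔤` the
`L²`-closure of `[W] = l2OfForms W` is invariant under `R(exp X)`. Proof (loc. cit.): for
`[f] ∈ [W]` and `u ⊥ [W]`, the coefficient `c(t) = ⟪u, R(exp tX) [f]⟫` is analytic on `ℝ`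
(`analyticAt_inner_rightRegular_of_zero`), `deriv c` is the coefficient of `[f_X]`,
`invQuot f_X = X (invQuot f) ∈ W` (`hasDerivAt_inner_rightRegular_toLp`), so inductively
`iteratedDeriv k c 0 = ⟪u, [f_k]⟫ = 0` with `[f_k] ∈ [W]`; by Taylor's formula `c = 0` near `0`,
hence on `ℝ`, i.e. `R(exp tX) [f] ∈ [W]ᗮᗮ = Cl[W]`; finally `R(exp X)` is continuous.
[cite: HarishChandraTAMS1953, Cor. to Thm. 2 (pp. 210–211)] -/
theorem closure_l2OfForms_exp_invariant_of_analytic {W : Submodule ℂ (𝒢.Adelic → ℂ)}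
    (hlie : ∀ X : 𝒟.arch.lie, ∀ φ ∈ W, lieDeriv 𝒟.ofArch X φ ∈ W)
    (hsm : ∀ φ ∈ W, IsArchSmooth 𝒟.ofArch φ)
    (hbd : ∀ φ ∈ W, ∃ C : ℝ, ∀ g, ‖φ g‖ ≤ C)
    (hrep : ∀ φ ∈ W, ∃ (f : 𝒢.automorphicQuotient → ℂ) (_ : MemLp f 2 μ), invQuot 𝒢 f = φ)
    (hana : ∀ (f : 𝒢.automorphicQuotient → ℂ) (hf : MemLp f 2 μ), invQuot 𝒢 f ∈ W →
      ∀ (X : 𝒟.arch.lie) (u : 𝒢.L2 μ),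
        AnalyticAt ℝ (fun t : ℝ ↦
          ⟪u, 𝒢.rightRegular μ (𝒟.ofArch (𝒟.arch.expMem (t • X))) (hf.toLp f)⟫_ℂ) 0)
    (X : 𝒟.arch.lie) {y : 𝒢.L2 μ} (hy : y ∈ (l2OfForms 𝒢 μ W).topologicalClosure) :
    𝒢.rightRegular μ (𝒟.ofArch (𝒟.arch.expMem X)) y ∈ (l2OfForms 𝒢 μ W).topologicalClosure := by
  -- notation: the coefficient of the class of `f` against `u`
  let coeff : (f : 𝒢.automorphicQuotient → ℂ) → MemLp f 2 μ → 𝒢.L2 μ → ℝ → ℂ :=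
    fun f hf u t ↦ ⟪u, 𝒢.rightRegular μ (𝒟.ofArch (𝒟.arch.expMem (t • X))) (hf.toLp f)⟫_ℂ
  -- (1) the derivative of a coefficient is the coefficient of the Lie derivative
  have hderiv : ∀ (f : 𝒢.automorphicQuotient → ℂ) (hf : MemLp f 2 μ), invQuot 𝒢 f ∈ W →
      ∀ u : 𝒢.L2 μ, ∃ (f' : 𝒢.automorphicQuotient → ℂ) (hf' : MemLp f' 2 μ),
        invQuot 𝒢 f' ∈ W ∧ deriv (coeff f hf u) = coeff f' hf' u := by
    intro f hf hfW u
    obtain ⟨f', hf', hf'eq⟩ := hrep _ (hlie X _ hfW)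
    obtain ⟨C, hC⟩ := hbd _ (hlie X _ hfW)
    refine ⟨f', hf', hf'eq ▸ hlie X _ hfW, funext fun t₀ ↦ ?_⟩
    exact (hasDerivAt_inner_rightRegular_toLp 𝒟 hf hf' (hsm _ hfW) X hf'eq.symm
      (fun g ↦ by rw [hf'eq]; exact hC g) u t₀).deriv
  -- (2) all iterated derivatives of a coefficient are coefficients of classes of `W`
  have hiter : ∀ (k : ℕ) (f : 𝒢.automorphicQuotient → ℂ) (hf : MemLp f 2 μ), invQuot 𝒢 f ∈ W →
      ∀ u : 𝒢.L2 μ, ∃ (f' : 𝒢.automorphicQuotient → ℂ) (hf' : MemLp f' 2 μ),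
        invQuot 𝒢 f' ∈ W ∧ iteratedDeriv k (coeff f hf u) = coeff f' hf' u := by
    intro k
    induction k with
    | zero => exact fun f hf hfW u ↦ ⟨f, hf, hfW, iteratedDeriv_zero⟩
    | succ k ih =>
      intro f hf hfW u
      obtain ⟨f₁, hf₁, hf₁W, h₁⟩ := hderiv f hf hfW u
      obtain ⟨f', hf', hf'W, h'⟩ := ih f₁ hf₁ hf₁W u
      exact ⟨f', hf', hf'W, by rw [iteratedDeriv_succ', h₁, h']⟩
  -- (3) coefficients against `u ⊥ [W]` vanish identically
  have hvanish : ∀ (f : 𝒢.automorphicQuotient → ℂ) (hf : MemLp f 2 μ), invQuot 𝒢 f ∈ W →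
      ∀ u ∈ (l2OfForms 𝒢 μ W)ᗮ, ∀ t : ℝ, coeff f hf u t = 0 := by
    intro f hf hfW u hu
    -- values at `0` of coefficients of classes of `W` against `u` vanish
    have hval0 : ∀ (f' : 𝒢.automorphicQuotient → ℂ) (hf' : MemLp f' 2 μ), invQuot 𝒢 f' ∈ W →
        coeff f' hf' u 0 = 0 := by
      intro f' hf' hf'W
      simp only [coeff, RealMatrixGroup.expMem_zero_smul, map_one, one_apply_eq_self]
      exact Submodule.inner_left_of_mem_orthogonal (toLp_mem_l2OfForms hf' hf'W) hu
    -- all iterated derivatives at `0` vanish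
    have hider0 : ∀ k : ℕ, iteratedDeriv k (coeff f hf u) 0 = 0 := by
      intro k
      obtain ⟨f', hf', hf'W, h'⟩ := hiter k f hf hfW u
      rw [h', hval0 f' hf' hf'W]
    -- analyticity on all of `ℝ`
    have han : AnalyticOnNhd ℝ (coeff f hf u) Set.univ := fun t₀ _ ↦
      analyticAt_inner_rightRegular_of_zero 𝒟 X (hf.toLp f) (hana f hf hfW X) u t₀
    -- Taylor: the coefficient vanishes near `0`
    have hzero : coeff f hf u =ᶠ[𝓝 0] 0 := by
      obtain ⟨p, r, hp⟩ := hana f hf hfW X u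
      filter_upwards [Metric.eball_mem_nhds (0 : ℝ) hp.r_pos] with s hs
      have hsum := hp.hasSum_iteratedFDeriv hs
      have hterm : (fun k : ℕ ↦ ((Nat.factorial k : ℕ) : ℝ)⁻¹ • iteratedFDeriv ℝ k (coeff f hf u) 0 fun _ ↦ s) =
          fun _ ↦ 0 := by
        funext k
        rw [iteratedFDeriv_apply_eq_iteratedDeriv_mul_prod, hider0 k, smul_zero, smul_zero]
      rw [hterm, zero_add] at hsum
      exact hsum.unique hasSum_zero
    -- identity theorem
    have heq := han.eqOn_zero_of_preconnected_of_eventuallyEq_zero isPreconnected_univ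
      (Set.mem_univ (0 : ℝ)) hzero
    exact fun t ↦ heq (Set.mem_univ t)
  -- (4) classes of `W` stay in `Cl[W] = [W]ᗮᗮ` under `R(exp tX)`
  have hgen : ∀ x ∈ l2OfForms 𝒢 μ W,
      𝒢.rightRegular μ (𝒟.ofArch (𝒟.arch.expMem X)) x ∈ (l2OfForms 𝒢 μ W).topologicalClosure := by
    rintro x ⟨f, hf, rfl, hfW⟩
    rw [← Submodule.orthogonal_orthogonal_eq_closure, Submodule.mem_orthogonal]
    intro u hu
    have := hvanish f hf hfW u hu 1
    simpa only [coeff, one_smul] using this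
  -- (5) continuity of `R(exp X)`
  exact apply_mem_topologicalClosure_of_forall_mem _ hgen hy

end Core

/-! ## Harish-Chandra's Lemma 34 for cuspidal `Π` on `GL_n` (named fact) and the two corollaries -/

section GeneralLinear

variable {n : ℕ} {K : Type} [Field K] [NumberField K]
  {hcpt : isCompact_glFiniteIntegralLevel n K}
  {μ : Measure (AdelicGroupData.gl n K).automorphicQuotient}
  [(AdelicGroupData.gl n K).IsAutomorphicMeasure μ]

variable (hcpt μ) in
/-- **`K`-finite vectors of a cuspidal `Π` are well-behaved: analyticity of their matrix
coefficients along one-parameter subgroups** (Harish-Chandra's Lemma 34 for cuspidal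
automorphic representations of `GL_n`, weak form). For an irreducible closed invariant
`Π ≤ L²_cusp(GL_n(𝔸_K) ⧸ A_G GL_n(K), μ)`, `f ∈ ℒ²(μ)` whose inversion `invQuot f = (g ↦ f [g⁻¹])`
lies in `V_Π = formsOfL2 hcpt μ Π` (so `[f] ∈ Π` is `K_∞`-finite and fixed by a level), `X ∈ 𝔤 =
𝔤𝔩_n(K_∞)` and `u ∈ L²(μ)`, the matrix coefficient `t ↦ ⟪u, R(exp tX) [f]⟫` is real analytic at
`t = 0`. In print: the irreducible unitary `Π` is admissible (Harish-Chandra 1953, Thm. 6,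
p. 230; Getz–Hahn 2024, Thm. 4.4.1; for cuspidal `Π` also Borel–Jacquet 1979, 4.6 and Getz–Hahn
Thm. 6.5.2), so every `K`-finite vector `ψ₀` of it is well-behaved, i.e. `x ↦ π(x) ψ₀` is an
analytic map on `G_∞` (Harish-Chandra 1953, Lemma 34, p. 228, with §7, p. 209), in particular
`g ↦ ⟨l, π(g) ψ₀⟩` is real analytic for every continuous functional `l` (Libine 2012,
Thm. 58 (b) and Thm. 72: `V_fini ⊆ V^ω`), and so is its restriction to `t ↦ exp tX`. Only this
weak form at `t = 0` is recorded (it is what the Corollary to Thm. 2 consumes; analyticity at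
every `t` follows, `analyticAt_inner_rightRegular_of_zero`). Not proved here (analytic vectors,
elliptic regularity and admissibility of `Π` are not in Mathlib).
[cite: HarishChandraTAMS1953, Lemma 34 (p. 228) and Thm. 6 (p. 230)] [cite: Libine2012, Thm. 58 (b) and Thm. 72] -/
def AutomorphicRepsGL.formsOfL2_coeff_analyticAt : Prop :=
  ∀ (P : CuspidalAutomorphicRepGL n K μ) (f : (AdelicGroupData.gl n K).automorphicQuotient → ℂ)
    (hf : MemLp f 2 μ), invQuot (AdelicGroupData.gl n K) f ∈ formsOfL2 hcpt μ P.1 →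
      ∀ (X : (AutomorphyDatum.gl n K hcpt).arch.lie) (u : (AdelicGroupData.gl n K).L2 μ),
        AnalyticAt ℝ (fun t : ℝ ↦ ⟪u, (AdelicGroupData.gl n K).rightRegular μ
          ((AutomorphyDatum.gl n K hcpt).ofArch ((AutomorphyDatum.gl n K hcpt).arch.expMem (t • X)))
            (hf.toLp f)⟫_ℂ) 0

/-- **Step 3a of Borel–Jacquet 4.6 from Harish-Chandra's Lemma 34** (and boundedness of cusp
forms): `cuspidal_bounded hcpt` and `formsOfL2_coeff_analyticAt hcpt μ` imply
`formsOfL2_closure_exp_invariant hcpt μ`. A stable `W ≤ V_Π` satisfies the hypotheses of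
`closure_l2OfForms_exp_invariant_of_analytic`: it is `𝔤`-stable, consists of automorphic forms
(archimedean-smooth), of cusp forms invariant under `A_G` (`formsOfL2_le_cuspFormsGL`,
`formsOfL2_center'_invariant`), hence bounded, and of inversions `invQuot f` of `f ∈ ℒ²(μ)` with
`[f] ∈ Π` (`exists_toLp_mem_of_mem_formsOfL2`), whose coefficients are analytic by the named
fact. Harish-Chandra 1953, Cor. to Thm. 2 and Lemma 34; Libine 2012, Cor. 73; Borel–Jacquet
1979, 4.6. [cite: HarishChandraTAMS1953, Cor. to Thm. 2 (pp. 210–211) and Lemma 34] -/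
theorem AutomorphicRepsGL.formsOfL2_closure_exp_invariant_of_coeff_analyticAt
    (hb : AutomorphicRepsGL.cuspidal_bounded hcpt)
    (hA : AutomorphicRepsGL.formsOfL2_coeff_analyticAt hcpt μ) :
    AutomorphicRepsGL.formsOfL2_closure_exp_invariant hcpt μ := by
  intro P W hWV hW X y hy
  refine closure_l2OfForms_exp_invariant_of_analytic (AutomorphyDatum.gl n K hcpt)
    hW.lie_stable (fun φ hφ ↦ ?_) (fun φ hφ ↦ ?_) (fun φ hφ ↦ ?_) (fun f hf hfW X u ↦ ?_) X hy
  · exact automorphicForms_le_archSmooth _ (hW.le_automorphicForms hφ)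
  · exact hb φ (AutomorphicRepsGL.formsOfL2_le_cuspFormsGL P.le_cuspidalSubspace (hWV hφ))
      (fun z hz g ↦ formsOfL2_center'_invariant P.1 (hWV hφ) hz g)
  · obtain ⟨f, hf, -, rfl, -⟩ := exists_toLp_mem_of_mem_formsOfL2 (hWV hφ)
    exact ⟨f, hf, rfl⟩
  · exact hA P f hf (hWV hfW) X u

/-- **Coefficients of finite sums of `K`-finite vectors of cuspidal `Π`'s are analytic**: given
`formsOfL2_coeff_analyticAt hcpt μ`, if `f ∈ ℒ²(μ)` has `invQuot f ∈ ⨆_Π V_Π` (a finite sum of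
elements of spaces `V_Π`), then `t ↦ ⟪u, R(exp tX) [f]⟫` is analytic at `0` for all `X ∈ 𝔤`,
`u ∈ L²(μ)` (induction over the sum: each summand is `invQuot fᵢ` with `fᵢ ∈ ℒ²(μ)`,
`exists_toLp_mem_of_mem_formsOfL2`; `invQuot` is injective and `[·]`, `R`, `⟪u, ·⟫` are additive;
sums of analytic functions are analytic). Getz–Hahn 2024, proof of Thm. 6.5.1 (p. 192); Harish-
Chandra 1953, Lemma 34. [cite: HarishChandraTAMS1953, Lemma 34 (p. 228)] -/
theorem AutomorphicRepsGL.coeff_analyticAt_of_mem_iSup_formsOfL2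
    (hA : AutomorphicRepsGL.formsOfL2_coeff_analyticAt hcpt μ)
    {f : (AdelicGroupData.gl n K).automorphicQuotient → ℂ} (hf : MemLp f 2 μ)
    (hmem : invQuot (AdelicGroupData.gl n K) f ∈
      ⨆ P : CuspidalAutomorphicRepGL n K μ, formsOfL2 hcpt μ P.1)
    (X : (AutomorphyDatum.gl n K hcpt).arch.lie) (u : (AdelicGroupData.gl n K).L2 μ) :
    AnalyticAt ℝ (fun t : ℝ ↦ ⟪u, (AdelicGroupData.gl n K).rightRegular μ
      ((AutomorphyDatum.gl n K hcpt).ofArch ((AutomorphyDatum.gl n K hcpt).arch.expMem (t • X)))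
        (hf.toLp f)⟫_ℂ) 0 := by
  -- the predicate carried through the sum
  let C : ((AdelicGroupData.gl n K).Adelic → ℂ) → Prop := fun φ ↦
    ∃ (f' : (AdelicGroupData.gl n K).automorphicQuotient → ℂ) (hf' : MemLp f' 2 μ),
      invQuot (AdelicGroupData.gl n K) f' = φ ∧ ∀ u' : (AdelicGroupData.gl n K).L2 μ,
        AnalyticAt ℝ (fun t : ℝ ↦ ⟪u', (AdelicGroupData.gl n K).rightRegular μ
          ((AutomorphyDatum.gl n K hcpt).ofArch ((AutomorphyDatum.gl n K hcpt).arch.expMem (t • X)))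
            (hf'.toLp f')⟫_ℂ) 0
  have hC : C (invQuot (AdelicGroupData.gl n K) f) := by
    refine Submodule.iSup_induction (fun P : CuspidalAutomorphicRepGL n K μ ↦ formsOfL2 hcpt μ P.1)
      (motive := C) hmem ?_ ?_ ?_
    · intro P φ hφ
      obtain ⟨f', hf', -, rfl, -⟩ := exists_toLp_mem_of_mem_formsOfL2 hφ
      exact ⟨f', hf', rfl, fun u' ↦ hA P f' hf' hφ X u'⟩
    · refine ⟨0, MemLp.zero, rfl, fun u' ↦ ?_⟩
      have h0 : (fun t : ℝ ↦ ⟪u', (AdelicGroupData.gl n K).rightRegular μ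
          ((AutomorphyDatum.gl n K hcpt).ofArch ((AutomorphyDatum.gl n K hcpt).arch.expMem (t • X)))
            (MemLp.zero.toLp (0 : (AdelicGroupData.gl n K).automorphicQuotient → ℂ))⟫_ℂ) =
          fun _ ↦ 0 := by
        funext t
        rw [MemLp.toLp_zero, map_zero, inner_zero_right]
      rw [h0]
      exact analyticAt_const
    · rintro φ ψ ⟨f₁, hf₁, rfl, h₁⟩ ⟨f₂, hf₂, rfl, h₂⟩
      refine ⟨f₁ + f₂, hf₁.add hf₂, rfl, fun u' ↦ ?_⟩
      have hadd : (fun t : ℝ ↦ ⟪u', (AdelicGroupData.gl n K).rightRegular μ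
          ((AutomorphyDatum.gl n K hcpt).ofArch ((AutomorphyDatum.gl n K hcpt).arch.expMem (t • X)))
            ((hf₁.add hf₂).toLp (f₁ + f₂))⟫_ℂ) =
          fun t : ℝ ↦ ⟪u', (AdelicGroupData.gl n K).rightRegular μ
            ((AutomorphyDatum.gl n K hcpt).ofArch ((AutomorphyDatum.gl n K hcpt).arch.expMem (t • X)))
              (hf₁.toLp f₁)⟫_ℂ +
            ⟪u', (AdelicGroupData.gl n K).rightRegular μ
              ((AutomorphyDatum.gl n K hcpt).ofArch ((AutomorphyDatum.gl n K hcpt).arch.expMem (t • X)))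
                (hf₂.toLp f₂)⟫_ℂ := by
        funext t
        rw [MemLp.toLp_add hf₁ hf₂, map_add, inner_add_right]
      rw [hadd]
      exact (h₁ u').add (h₂ u')
  obtain ⟨f', hf', hff', han⟩ := hC
  obtain rfl : f' = f := invQuot_injective _ hff'
  exact han u

/-- **Analyticity of the coefficients of square-integrable cusp forms** (Getz–Hahn 2024, proof of
Thm. 6.5.1, p. 192: `𝒜^{A_G}_cusp ≤ L²_cusp = ⊕̂_π L²_cusp(π)`, each element having components in
finitely many summands, each a `K`-finite — hence well-behaved — vector): given
`invQuot_mem_iSup_formsOfL2 hcpt μ` and `formsOfL2_coeff_analyticAt hcpt μ`, for `f ∈ ℒ²(μ)`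
with `invQuot f` in the space of cusp forms `𝒜₀` the coefficients `t ↦ ⟪u, R(exp tX) [f]⟫` are
analytic at `0` (`[f] ∈ L²_cusp` by `toLp_mem_cuspidalSubspace_of_invQuot_mem_cuspFormsGL`).
Harish-Chandra 1953, Lemma 34. [cite: HarishChandraTAMS1953, Lemma 34 (p. 228)] -/
theorem AutomorphicRepsGL.cuspidal_coeff_analyticAt_of
    (hiso : AutomorphicRepsGL.invQuot_mem_iSup_formsOfL2 hcpt μ)
    (hA : AutomorphicRepsGL.formsOfL2_coeff_analyticAt hcpt μ)
    {f : (AdelicGroupData.gl n K).automorphicQuotient → ℂ} (hf : MemLp f 2 μ)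
    (hW : invQuot (AdelicGroupData.gl n K) f ∈ cuspFormsGL n K hcpt)
    (X : (AutomorphyDatum.gl n K hcpt).arch.lie) (u : (AdelicGroupData.gl n K).L2 μ) :
    AnalyticAt ℝ (fun t : ℝ ↦ ⟪u, (AdelicGroupData.gl n K).rightRegular μ
      ((AutomorphyDatum.gl n K hcpt).ofArch ((AutomorphyDatum.gl n K hcpt).arch.expMem (t • X)))
        (hf.toLp f)⟫_ℂ) 0 :=
  AutomorphicRepsGL.coeff_analyticAt_of_mem_iSup_formsOfL2 hA hf
    (hiso f hf (toLp_mem_cuspidalSubspace_of_invQuot_mem_cuspFormsGL hf hW) hW) X u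

/-- **Harish-Chandra's closure theorem for spaces of cusp forms on `GL_n` from Lemma 34**:
`cuspidal_bounded hcpt`, `invQuot_mem_iSup_formsOfL2 hcpt μ` and `formsOfL2_coeff_analyticAt hcpt μ`
imply `cuspidal_closure_exp_invariant hcpt μ`. A stable `W ≤ 𝒜₀` of `A_G`-invariant cusp forms
satisfies the hypotheses of `closure_l2OfForms_exp_invariant_of_analytic`: `𝔤`-stable,
archimedean-smooth, bounded (`cuspidal_bounded`), represented by `ℒ²`-functions
(`exists_toLp_mem_cuspidalSubspace_of_bounded`), with analytic coefficients
(`cuspidal_coeff_analyticAt_of`). Harish-Chandra 1953, Cor. to Thm. 2 and Lemma 34; Libine 2012,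
Cor. 73; Getz–Hahn 2024, proof of Thm. 6.5.1. [cite: HarishChandraTAMS1953, Cor. to Thm. 2 (pp. 210–211) and Lemma 34] -/
theorem AutomorphicRepsGL.cuspidal_closure_exp_invariant_of_coeff_analyticAt
    (hb : AutomorphicRepsGL.cuspidal_bounded hcpt)
    (hiso : AutomorphicRepsGL.invQuot_mem_iSup_formsOfL2 hcpt μ)
    (hA : AutomorphicRepsGL.formsOfL2_coeff_analyticAt hcpt μ) :
    AutomorphicRepsGL.cuspidal_closure_exp_invariant hcpt μ := by
  intro W hW hWc hWA X y hy
  refine closure_l2OfForms_exp_invariant_of_analytic (AutomorphyDatum.gl n K hcpt)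
    hW.lie_stable (fun φ hφ ↦ ?_) (fun φ hφ ↦ hb φ (hWc hφ) (hWA φ hφ)) (fun φ hφ ↦ ?_)
    (fun f hf hfW X u ↦ ?_) X hy
  · exact automorphicForms_le_archSmooth _ (cuspFormsGL_le_automorphicForms n K hcpt (hWc hφ))
  · obtain ⟨f, hf, -, hfφ, -⟩ :=
      AutomorphicRepsGL.exists_toLp_mem_cuspidalSubspace_of_bounded (μ := μ)
        (hWc hφ) (hWA φ hφ) (hb φ (hWc hφ) (hWA φ hφ))
    exact ⟨f, hf, hfφ⟩
  · exact AutomorphicRepsGL.cuspidal_coeff_analyticAt_of hiso hA hf (hWc hfW) X u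

end GeneralLinear

end Literature.NumberTheory.Automorphic
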